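import Mathlib
import Summits.CriticalPhenomena.CardyFormulaZ2.Theorems.CardyMagicRigidityNestingRigidityTransferReconstruction
import Summits.CriticalPhenomena.CardyFormulaZ2.Theorems.CardyMagicRigidityNestingRigidityTreeRigidityNeedleLoops
import Summits.CriticalPhenomena.CardyFormulaZ2.Theorems.CardyMagicRigidityNestingRigidityTreeRigidityFamilySwitchNeedle
import HarnessLib

/-!
# Stub `stub_treeRigidity`: family-by-family count laws do not determine the law (route-gap witness)

Crux `Summit.CriticalPhenomena.CardyFormulaZ2.Theses.CardyMagicRigidity.NestingRigidity`
(stmt-CriticalPhenomena-4835), line `positive-cone-weight-doubling`, registered stub `stub_treeRigidity`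
(= `TreeRigidity` of `…PositiveConeDefs`: doubly convergent `Regular` limits `X`, `X'` on `([0,1], Leb)` +
`NestingLawAgreement` ⇒ `d_CN(bond_{δₖ}, site_{δₖ}) → 0`).  Its hypothesis `NestingLawAgreement` — and
its source, the single-cloud tomography `RingTomography → PGFUniqueness` — delivers agreement of the joint
law of the pattern counts `(N_S)_{S ≠ ∅}` ONE DISC FAMILY AT A TIME, whereas the reconstruction step (2)
(`…TransferRigidity`, `…TreeRigidityReconstruction`) consumes the JOINT law of the one- and two-disc
surround counts over all rational data.  This file proves that the gap is a genuine SECOND MISSTATEMENT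
of the stub (after the traversal gap of `…RegularNotRigid`), by a law-level witness in the exact shape of
the stub's hypotheses:

`exists_regular_laws_familywise_eq_jointly_ne` (registered anchor) — two random configurations `X`, `X'`
on `([0,1], Leb)`, SURELY `Regular` (every loop even of covering degree `{0, 1}`, hence single-signed),
such that for EVERY disc family (any number of discs, any centres, ALL radii and windows — not just a.e.)
and every count vector `k` the cylinder probabilities `Leb{∀ S ≠ ∅, N_S = k_S}` of `X` and `X'` coincide,
while a JOINT cylinder of two one-disc families has probability `1/2` under `X` and `0` under `X'`, and
`cnLawEDist(X, X') ≥ 1/2`.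

WITNESS (the "family switch").  Four loops sharing the needle `ν = [1, 2] ⊆ ℝ`: the circle `a = C(0, 2)`;
`a'` = the same circle followed by the needle `2 → 1 → 2` (interior the slit disc `B(0,2) ∖ ν`, trace
`C(0,2) ∪ ν` = its frontier: `Regular`!); `b` = `C(3/2, 1/2)` + the needle (a retraced diameter);
`b'` = `C(1, 1)` + the needle (`…TreeRigidityNeedleLoops`).  `X` is the uniform mixture of `{a, b}` and
`{a', b'}`, `X'` that of `{a, b'}` and `{a', b}`.  A closed disc meeting `ν` is CUT by `a'`, `b`, `b'`
(neither surrounded nor avoided), which are then invisible to the whole family; a family all of whose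
discs miss `ν` cannot tell `a` from `a'`.  Either way the two mixtures produce the same pair of count
vectors (`patternCount_switch`, `…FamilySwitchConfigs`), while `E = B̄(3/2, 1/10)` (meets `ν`) and
`D = B̄(1/2, 1/10)` (inside `int a ∩ int a' ∩ int b'`, outside `int b`) have joint surround counts
`(1,1), (0,2)` under `X` and `(1,2), (0,1)` under `X'`; no loop of one mixture component is within loop
distance `1` of a loop of the other.

MORAL for the reshape: single-family agreement (tilted moments of ONE cloud family at a time) must be
strengthened to JOINT agreement across finitely many disc families — equivalently `TiltAgreementAt` /
`LawAgreementAt` for PRODUCTS over several families, i.e. clouds superposing several disc families with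
independent weights; needles (retraced inward arcs, allowed by `Regular.boundary`) are what makes the
single-family data blind here, so a "solid interior" support clause (`int u` regular open) is the natural
companion strengthening on the precompactness side.
-/

noncomputable section

open MeasureTheory Set Filter Metric
open scoped Real Topology BigOperators ENNReal

namespace Summit.CriticalPhenomena.CardyFormulaZ2.Cruxes.NestingRigidity.PositiveConeWeightDoubling

open Literature.Probability.RandomPlanarGeometry
open Summit.CriticalPhenomena.CardyFormulaZ2.Cruxes.NestingRigidity.RingCloudTomography


open FamilySwitch NeedleLoops

/-! ## §3 The witness -/

open Classical in
/-- **Family-by-family agreement of the pattern-count laws does not determine the law of a regular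
random configuration — not even the joint law of two one-disc surround counts (registered anchor;
route-gap witness for `stub_treeRigidity`).**  There are random configurations `X`, `X'` on
`([0,1], Leb)`, surely `Regular` with all loops of covering degree `{0, 1}`, such that (i) for every number
of discs, all centres, radii and windows and every count vector the cylinder probabilities of
`(N_S)_{S ≠ ∅}` under `X` and `X'` are EQUAL; (ii) the joint event "`B̄(3/2, 1/10)` is surrounded by
exactly one loop of the window `B(0, 3)` and so is `B̄(1/2, 1/10)`" has probability `1/2` under `X` and
`0` under `X'`; (iii) `cnLawEDist(X, X') ≥ 1/2`.  See the module docstring for the witness and the moral. -/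
theorem exists_regular_laws_familywise_eq_jointly_ne :
    ∃ X X' : unitInterval → LoopConfig ℂ, (∀ s, Regular (X s)) ∧ (∀ s, Regular (X' s)) ∧
      (∀ s, ∀ u ∈ (X s).loops ∪ (X' s).loops, ∀ z, u.wind z = 0 ∨ u.wind z = 1) ∧
      (∀ (n : ℕ) (x : Fin n → ℂ) (r : Fin n → ℝ) (R : ℝ) (k : Finset (Fin n) → ℕ),
        volume {s | ∀ S : Finset (Fin n), S.Nonempty → patternCount (X s) x r R S = k S} =
          volume {s | ∀ S : Finset (Fin n), S.Nonempty → patternCount (X' s) x r R S = k S}) ∧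
      volume {s | patternCount (X s) ![(3 / 2 : ℂ)] ![(1 / 10 : ℝ)] 3 Finset.univ = 1 ∧
          patternCount (X s) ![(1 / 2 : ℂ)] ![(1 / 10 : ℝ)] 3 Finset.univ = 1} = ENNReal.ofReal (1 / 2) ∧
      volume {s | patternCount (X' s) ![(3 / 2 : ℂ)] ![(1 / 10 : ℝ)] 3 Finset.univ = 1 ∧
          patternCount (X' s) ![(1 / 2 : ℂ)] ![(1 / 10 : ℝ)] 3 Finset.univ = 1} = 0 ∧
      ENNReal.ofReal (1 / 2) ≤ LoopConfig.cnLawEDist volume X volume X' := by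
  /- ### the needle and the four loops -/
  have hνc : IsClosed (segment ℝ (1 : ℂ) 2) := isClosed_needle
  have hνi : interior (segment ℝ (1 : ℂ) 2) = ∅ := interior_needle
  have hν0 : segment ℝ (1 : ℂ) 2 ⊆ closedBall (0 : ℂ) 2 := needle_subset_closedBall_zero
  have hν1 : segment ℝ (1 : ℂ) 2 ⊆ closedBall (3 / 2 : ℂ) (1 / 2) := by
    have := needle_subset_closedBall (c := 3 / 2) (ρ := 1 / 2) (by norm_num) (by norm_num)
    push_cast at this
    exact this
  have hν2 : segment ℝ (1 : ℂ) 2 ⊆ closedBall (1 : ℂ) 1 := by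
    simpa using needle_subset_closedBall (c := 1) (ρ := 1) (by norm_num) (by norm_num)
  obtain ⟨a, har, ha1, ha0⟩ := exists_lobeLoop 0 2 two_ne_zero
  obtain ⟨a', ha'r, ha'ν, ha'1, ha'0⟩ := exists_needledLobeLoop 0 2 1 two_ne_zero
  obtain ⟨b, hbr, hbν, hb1, hb0⟩ := exists_needledLobeLoop (3 / 2) 2 1 (by norm_num)
  obtain ⟨b', hb'r, hb'ν, hb'1, hb'0⟩ := exists_needledLobeLoop 1 2 1 (by norm_num)
  have e2 : ‖(2 : ℂ) - 0‖ = 2 := by simp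
  have e32 : ‖(2 : ℂ) - 3 / 2‖ = 1 / 2 := by
    rw [show (2 : ℂ) - 3 / 2 = ((1 / 2 : ℝ) : ℂ) by push_cast; norm_num, Complex.norm_real]
    norm_num
  have e1 : ‖(2 : ℂ) - 1‖ = 1 := by norm_num
  rw [e2] at har ha1 ha0 ha'r ha'1 ha'0
  rw [e32] at hbr hb1 hb0
  rw [e1] at hb'r hb'1 hb'0
  rw [segment_symm ℝ (2 : ℂ) 1] at ha'r ha'ν ha'1 ha'0 hbr hbν hb1 hb0 hb'r hb'ν hb'1 hb'0
  -- interiors and degrees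
  obtain ⟨hIa, hda⟩ := interior_of_lobe ha1 ha0
  obtain ⟨hIa', hda'⟩ := interior_of_needled ha'ν ha'1 ha'0
  obtain ⟨hIb, hdb⟩ := interior_of_needled hbν hb1 hb0
  obtain ⟨hIb', hdb'⟩ := interior_of_needled hb'ν hb'1 hb'0
  -- boundary property
  have hba : a.range = frontier {z | a.wind z ≠ 0} := by rw [har, hIa, frontier_ball _ two_ne_zero]
  have hba' : a'.range = frontier {z | a'.wind z ≠ 0} := by
    rw [ha'r, hIa', frontier_ball_diff two_pos hνc hνi hν0]
  have hbb : b.range = frontier {z | b.wind z ≠ 0} := by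
    rw [hbr, hIb, frontier_ball_diff (by norm_num) hνc hνi hν1]
  have hbb' : b'.range = frontier {z | b'.wind z ≠ 0} := by
    rw [hb'r, hIb', frontier_ball_diff one_pos hνc hνi hν2]
  /- ### elementary distances -/
  have d32 : dist (3 / 2 : ℂ) 0 = 3 / 2 := by
    rw [dist_zero_right, show (3 / 2 : ℂ) = ((3 / 2 : ℝ) : ℂ) by push_cast; rfl, Complex.norm_real]
    norm_num
  have d10 : dist (1 : ℂ) 0 = 1 := by simp
  have hB1 : ball (3 / 2 : ℂ) (1 / 2) ⊆ ball 0 2 := fun z hz ↦ by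
    rw [mem_ball] at hz ⊢
    linarith [dist_triangle z (3 / 2 : ℂ) 0]
  have hB2 : ball (1 : ℂ) 1 ⊆ ball 0 2 := fun z hz ↦ by
    rw [mem_ball] at hz ⊢
    linarith [dist_triangle z (1 : ℂ) 0]
  have h0a : (0 : ℂ) ∈ ball (0 : ℂ) 2 := mem_ball_self two_pos
  have h0ν : (0 : ℂ) ∉ segment ℝ (1 : ℂ) 2 := fun h ↦ by
    have := (mem_needle_iff.1 h).2.1; simp at this; linarith
  have h0b : (0 : ℂ) ∉ ball (3 / 2 : ℂ) (1 / 2) := by rw [mem_ball, dist_comm, d32]; norm_num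
  have h0b' : (0 : ℂ) ∉ ball (1 : ℂ) 1 := by rw [mem_ball, dist_comm, d10]; norm_num
  -- nesting and distinctness of interiors, distinctness of loops
  have hne_ab : {z | a.wind z ≠ 0} ≠ {z | b.wind z ≠ 0} := fun h ↦ by
    rw [hIa, hIb] at h; exact h0b (h.subset h0a).1
  have hne_ab' : {z | a.wind z ≠ 0} ≠ {z | b'.wind z ≠ 0} := fun h ↦ by
    rw [hIa, hIb'] at h; exact h0b' (h.subset h0a).1
  have hne_a'b : {z | a'.wind z ≠ 0} ≠ {z | b.wind z ≠ 0} := fun h ↦ by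
    rw [hIa', hIb] at h; exact h0b (h.subset ⟨h0a, h0ν⟩).1
  have hne_a'b' : {z | a'.wind z ≠ 0} ≠ {z | b'.wind z ≠ 0} := fun h ↦ by
    rw [hIa', hIb'] at h; exact h0b' (h.subset ⟨h0a, h0ν⟩).1
  have hab : a ≠ b := fun h ↦ hne_ab (by rw [h])
  have hab' : a ≠ b' := fun h ↦ hne_ab' (by rw [h])
  have ha'b : a' ≠ b := fun h ↦ hne_a'b (by rw [h])
  have ha'b' : a' ≠ b' := fun h ↦ hne_a'b' (by rw [h])
  /- ### the four configurations are regular -/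
  have hF0 : ∀ u v : UnbasedLoop ℂ, (⟨fun j ↦ if j = 0 then {u, v} else ∅⟩ : LoopConfig ℂ).F 0 = {u, v} :=
    fun u v ↦ show (if (0 : Fin 2) = 0 then ({u, v} : Set (UnbasedLoop ℂ)) else ∅) = {u, v} from
      if_pos rfl
  have hF1 : ∀ u v : UnbasedLoop ℂ, (⟨fun j ↦ if j = 0 then {u, v} else ∅⟩ : LoopConfig ℂ).F 1 = ∅ :=
    fun u v ↦ show (if (1 : Fin 2) = 0 then ({u, v} : Set (UnbasedLoop ℂ)) else ∅) = ∅ from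
      if_neg (by decide)
  have regAB : Regular ⟨fun j ↦ if j = 0 then {a, b} else ∅⟩ :=
    regular_of_loops_eq_pair _ a b (hF0 a b) (hF1 a b) hda hdb hba hbb
      (by rw [hIa, hIb]; exact sdiff_subset.trans hB1) hne_ab
  have regAB' : Regular ⟨fun j ↦ if j = 0 then {a, b'} else ∅⟩ :=
    regular_of_loops_eq_pair _ a b' (hF0 a b') (hF1 a b') hda hdb' hba hbb'
      (by rw [hIa, hIb']; exact sdiff_subset.trans hB2) hne_ab'
  have regA'B : Regular ⟨fun j ↦ if j = 0 then {a', b} else ∅⟩ :=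
    regular_of_loops_eq_pair _ a' b (hF0 a' b) (hF1 a' b) hda' hdb hba' hbb
      (by rw [hIa', hIb]; exact sdiff_subset_sdiff_left hB1) hne_a'b
  have regA'B' : Regular ⟨fun j ↦ if j = 0 then {a', b'} else ∅⟩ :=
    regular_of_loops_eq_pair _ a' b' (hF0 a' b') (hF1 a' b') hda' hdb' hba' hbb'
      (by rw [hIa', hIb']; exact sdiff_subset_sdiff_left hB2) hne_a'b'
  /- ### the switch hypotheses -/
  have h2a : (2 : ℂ) ∈ a.range := by rw [har, mem_sphere, dist_zero_right]; simp
  have hr : a'.range = a.range ∪ segment ℝ (1 : ℂ) 2 := by rw [ha'r, har]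
  have hi : {w | a'.wind w ≠ 0} = {w | a.wind w ≠ 0} \ segment ℝ (1 : ℂ) 2 := by rw [hIa', hIa]
  have hνA : segment ℝ (1 : ℂ) 2 ⊆ {w | a.wind w ≠ 0} ∪ a.range := by
    rw [hIa, har, ball_union_sphere]; exact hν0
  have hwin : ∀ R : ℝ, a.range ⊆ ball (0 : ℂ) R → segment ℝ (1 : ℂ) 2 ⊆ ball (0 : ℂ) R := by
    intro R h z hz
    have h2R := h h2a
    rw [mem_ball, dist_zero_right] at h2R ⊢
    have hz2 : ‖z‖ ≤ 2 := by simpa using hν0 hz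
    have : ‖(2 : ℂ)‖ = 2 := by simp
    linarith
  have hνb : segment ℝ (1 : ℂ) 2 ⊆ b.range := by rw [hbr]; exact subset_union_right
  have hνbi : Disjoint (segment ℝ (1 : ℂ) 2) {w | b.wind w ≠ 0} := by
    rw [hIb]; exact disjoint_sdiff_right
  have hνb' : segment ℝ (1 : ℂ) 2 ⊆ b'.range := by rw [hb'r]; exact subset_union_right
  have hνb'i : Disjoint (segment ℝ (1 : ℂ) 2) {w | b'.wind w ≠ 0} := by
    rw [hIb']; exact disjoint_sdiff_right
  /- ### ranges, windows and loop distances -/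
  have hRa : a.range ⊆ closedBall (0 : ℂ) 2 := by rw [har]; exact sphere_subset_closedBall
  have hRa' : a'.range ⊆ closedBall (0 : ℂ) 2 := by
    rw [ha'r]; exact union_subset sphere_subset_closedBall hν0
  have hRb : b.range ⊆ closedBall (3 / 2 : ℂ) (1 / 2) := by
    rw [hbr]; exact union_subset sphere_subset_closedBall hν1
  have hRb' : b'.range ⊆ closedBall (1 : ℂ) 1 := by
    rw [hb'r]; exact union_subset sphere_subset_closedBall hν2
  have hRb0 : b.range ⊆ closedBall (0 : ℂ) 2 := hRb.trans fun z hz ↦ by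
    rw [mem_closedBall] at hz ⊢; linarith [dist_triangle z (3 / 2 : ℂ) 0]
  have hRb'0 : b'.range ⊆ closedBall (0 : ℂ) 2 := hRb'.trans fun z hz ↦ by
    rw [mem_closedBall] at hz ⊢; linarith [dist_triangle z (1 : ℂ) 0]
  have hm2a : (-2 : ℂ) ∈ a.range := by rw [har, mem_sphere, dist_zero_right]; simp
  have hm2a' : (-2 : ℂ) ∈ a'.range := by rw [hr]; exact Or.inl hm2a
  have h0b'r : (0 : ℂ) ∈ b'.range := by rw [hb'r]; left; rw [mem_sphere, dist_comm, d10]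
  have h1a' : (1 : ℂ) ∈ a'.range := by rw [ha'r]; exact Or.inr (left_mem_segment ℝ _ _)
  have dm232 : dist (-2 : ℂ) (3 / 2) = 7 / 2 := by
    rw [dist_eq_norm, show (-2 : ℂ) - 3 / 2 = ((-(7 / 2) : ℝ) : ℂ) by push_cast; ring, Complex.norm_real]
    norm_num
  have dm21 : dist (-2 : ℂ) 1 = 3 := by
    rw [dist_eq_norm, show (-2 : ℂ) - 1 = ((-3 : ℝ) : ℂ) by push_cast; ring, Complex.norm_real]
    norm_num
  -- `b`-type loops are `≥ 1` away from `a`-type loops, `a` from `a'`, `b` from `b'`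
  have hD_ab : (1 : ℝ) ≤ a.udist b := le_udist_of_forall_le_dist hm2a fun y hy ↦ by
    have := hRb hy; rw [mem_closedBall] at this; linarith [dist_triangle (-2 : ℂ) y (3 / 2)]
  have hD_a'b' : (1 : ℝ) ≤ a'.udist b' := le_udist_of_forall_le_dist hm2a' fun y hy ↦ by
    have := hRb' hy; rw [mem_closedBall] at this; linarith [dist_triangle (-2 : ℂ) y 1]
  have hD_a'a : (1 : ℝ) ≤ a'.udist a := le_udist_of_forall_le_dist h1a' fun y hy ↦ by
    rw [har, mem_sphere] at hy; linarith [dist_triangle y (1 : ℂ) 0, dist_comm (1 : ℂ) y]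
  have hD_b'b : (1 : ℝ) ≤ b'.udist b := le_udist_of_forall_le_dist h0b'r fun y hy ↦ by
    have := hRb hy; rw [mem_closedBall] at this
    linarith [dist_triangle (0 : ℂ) y (3 / 2), d32, dist_comm (3 / 2 : ℂ) 0]
  have hD_ba : (1 : ℝ) ≤ b.udist a := by rwa [UnbasedLoop.udist_comm]
  have hD_aa' : (1 : ℝ) ≤ a.udist a' := by rwa [UnbasedLoop.udist_comm]
  have hD_bb' : (1 : ℝ) ≤ b.udist b' := by rwa [UnbasedLoop.udist_comm]
  have hD_b'a' : (1 : ℝ) ≤ b'.udist a' := by rwa [UnbasedLoop.udist_comm]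
  /- ### the two one-disc counts on the four configurations -/
  have hE : closedBall (3 / 2 : ℂ) (1 / 10) ⊆ ball (0 : ℂ) 2 := fun z hz ↦ by
    rw [mem_closedBall] at hz; rw [mem_ball]; linarith [dist_triangle z (3 / 2 : ℂ) 0]
  have hE' : ∀ s : Set ℂ, ¬ closedBall (3 / 2 : ℂ) (1 / 10) ⊆ s \ segment ℝ (1 : ℂ) 2 := fun s h ↦
    (h (mem_closedBall_self (by norm_num))).2 (mem_needle_iff.2 ⟨by simp, by simp; norm_num, by simp; norm_num⟩)
  have hDν : Disjoint (closedBall (1 / 2 : ℂ) (1 / 10)) (segment ℝ (1 : ℂ) 2) := by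
    refine Set.disjoint_left.2 fun z hz hzν ↦ ?_
    obtain ⟨-, hz1, -⟩ := mem_needle_iff.1 hzν
    rw [mem_closedBall, dist_eq_norm] at hz
    have := Complex.abs_re_le_norm (z - 1 / 2)
    simp only [Complex.sub_re] at this
    norm_num at this
    linarith [(abs_le.1 (this.trans hz)).2]
  have hD1 : closedBall (1 / 2 : ℂ) (1 / 10) ⊆ ball (0 : ℂ) 2 := fun z hz ↦ by
    rw [mem_closedBall] at hz; rw [mem_ball]
    have : dist (1 / 2 : ℂ) 0 = 1 / 2 := by
      rw [dist_zero_right, show (1 / 2 : ℂ) = ((1 / 2 : ℝ) : ℂ) by push_cast; rfl, Complex.norm_real]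
      norm_num
    linarith [dist_triangle z (1 / 2 : ℂ) 0]
  have hD2 : closedBall (1 / 2 : ℂ) (1 / 10) ⊆ ball (1 : ℂ) 1 := fun z hz ↦ by
    rw [mem_closedBall] at hz; rw [mem_ball]
    have : dist (1 / 2 : ℂ) 1 = 1 / 2 := by
      rw [dist_eq_norm, show (1 / 2 : ℂ) - 1 = ((-(1 / 2) : ℝ) : ℂ) by push_cast; ring, Complex.norm_real]
      norm_num
    linarith [dist_triangle z (1 / 2 : ℂ) 1]
  have hD3 : ¬ closedBall (1 / 2 : ℂ) (1 / 10) ⊆ ball (3 / 2 : ℂ) (1 / 2) \ segment ℝ (1 : ℂ) 2 := fun h ↦ by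
    have := (h (mem_closedBall_self (by norm_num))).1
    rw [mem_ball, dist_eq_norm, show (1 / 2 : ℂ) - 3 / 2 = ((-1 : ℝ) : ℂ) by push_cast; ring,
      Complex.norm_real] at this
    norm_num at this
  have hW3 : closedBall (0 : ℂ) 2 ⊆ ball (0 : ℂ) 3 := closedBall_subset_ball (by norm_num)
  -- `N^E`: only `a` surrounds `E = B̄(3/2, 1/10)`; `N^D`: `a`, `a'`, `b'` surround `D = B̄(1/2, 1/10)`
  have NE : ∀ u v : UnbasedLoop ℂ, u ≠ v →
      patternCount (⟨fun j ↦ if j = 0 then {u, v} else ∅⟩ : LoopConfig ℂ) ![(3 / 2 : ℂ)] ![(1 / 10 : ℝ)] 3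
        Finset.univ = (if u.range ⊆ ball (0 : ℂ) 3 ∧ closedBall (3 / 2 : ℂ) (1 / 10) ⊆ {w | u.wind w ≠ 0}
          then 1 else 0) + (if v.range ⊆ ball (0 : ℂ) 3 ∧ closedBall (3 / 2 : ℂ) (1 / 10) ⊆
          {w | v.wind w ≠ 0} then 1 else 0) := fun u v huv ↦ by
    rw [patternCount_fin_one_univ, loops_pairConfig]; convert ncard_pair_sep huv _
  have ND : ∀ u v : UnbasedLoop ℂ, u ≠ v →
      patternCount (⟨fun j ↦ if j = 0 then {u, v} else ∅⟩ : LoopConfig ℂ) ![(1 / 2 : ℂ)] ![(1 / 10 : ℝ)] 3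
        Finset.univ = (if u.range ⊆ ball (0 : ℂ) 3 ∧ closedBall (1 / 2 : ℂ) (1 / 10) ⊆ {w | u.wind w ≠ 0}
          then 1 else 0) + (if v.range ⊆ ball (0 : ℂ) 3 ∧ closedBall (1 / 2 : ℂ) (1 / 10) ⊆
          {w | v.wind w ≠ 0} then 1 else 0) := fun u v huv ↦ by
    rw [patternCount_fin_one_univ, loops_pairConfig]; convert ncard_pair_sep huv _
  have NEab : patternCount (⟨fun j ↦ if j = 0 then {a, b} else ∅⟩ : LoopConfig ℂ) ![(3 / 2 : ℂ)]
      ![(1 / 10 : ℝ)] 3 Finset.univ = 1 := by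
    rw [NE a b hab, if_pos ⟨hRa.trans hW3, hIa ▸ hE⟩, if_neg fun h ↦ hE' _ (hIb ▸ h.2)]
  have NEa'b' : patternCount (⟨fun j ↦ if j = 0 then {a', b'} else ∅⟩ : LoopConfig ℂ) ![(3 / 2 : ℂ)]
      ![(1 / 10 : ℝ)] 3 Finset.univ = 0 := by
    rw [NE a' b' ha'b', if_neg fun h ↦ hE' _ (hIa' ▸ h.2), if_neg fun h ↦ hE' _ (hIb' ▸ h.2)]
  have NEa'b : patternCount (⟨fun j ↦ if j = 0 then {a', b} else ∅⟩ : LoopConfig ℂ) ![(3 / 2 : ℂ)]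
      ![(1 / 10 : ℝ)] 3 Finset.univ = 0 := by
    rw [NE a' b ha'b, if_neg fun h ↦ hE' _ (hIa' ▸ h.2), if_neg fun h ↦ hE' _ (hIb ▸ h.2)]
  have NDab : patternCount (⟨fun j ↦ if j = 0 then {a, b} else ∅⟩ : LoopConfig ℂ) ![(1 / 2 : ℂ)]
      ![(1 / 10 : ℝ)] 3 Finset.univ = 1 := by
    rw [ND a b hab, if_pos ⟨hRa.trans hW3, hIa ▸ hD1⟩, if_neg fun h ↦ hD3 (hIb ▸ h.2)]
  have NDab' : patternCount (⟨fun j ↦ if j = 0 then {a, b'} else ∅⟩ : LoopConfig ℂ) ![(1 / 2 : ℂ)]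
      ![(1 / 10 : ℝ)] 3 Finset.univ = 2 := by
    rw [ND a b' hab', if_pos ⟨hRa.trans hW3, hIa ▸ hD1⟩,
      if_pos ⟨hRb'0.trans hW3, hIb' ▸ subset_sdiff.2 ⟨hD2, hDν⟩⟩]
  /- ### the two laws -/
  refine ⟨fun s ↦ if s < ⟨1 / 2, half_mem_unitInterval⟩ then ⟨fun j ↦ if j = 0 then {a, b} else ∅⟩
      else ⟨fun j ↦ if j = 0 then {a', b'} else ∅⟩,
    fun s ↦ if s < ⟨1 / 2, half_mem_unitInterval⟩ then ⟨fun j ↦ if j = 0 then {a, b'} else ∅⟩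
      else ⟨fun j ↦ if j = 0 then {a', b} else ∅⟩, fun s ↦ ?_, fun s ↦ ?_, fun s u hu z ↦ ?_,
    fun n x r R k ↦ ?_, ?_, ?_, ?_⟩
  · dsimp only; split_ifs; exacts [regAB, regA'B']
  · dsimp only; split_ifs; exacts [regAB', regA'B]
  · -- degrees
    dsimp only at hu
    split_ifs at hu <;> rw [loops_pairConfig, loops_pairConfig] at hu
    · rcases hu with (rfl | rfl) | (rfl | rfl)
      exacts [hda z, hdb z, hda z, hdb' z]
    · rcases hu with (rfl | rfl) | (rfl | rfl)
      exacts [hda' z, hdb' z, hda' z, hdb z]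
  · -- single-family cylinders agree
    rw [volume_setOf_apply_ite_lt_half (fun c : LoopConfig ℂ ↦
        ∀ S : Finset (Fin n), S.Nonempty → patternCount c x r R S = k S),
      volume_setOf_apply_ite_lt_half (fun c : LoopConfig ℂ ↦
        ∀ S : Finset (Fin n), S.Nonempty → patternCount c x r R S = k S)]
    set PAB : Prop := ∀ S : Finset (Fin n), S.Nonempty →
      patternCount (⟨fun j ↦ if j = 0 then {a, b} else ∅⟩ : LoopConfig ℂ) x r R S = k S with hPAB
    set PA'B' : Prop := ∀ S : Finset (Fin n), S.Nonempty →
      patternCount (⟨fun j ↦ if j = 0 then {a', b'} else ∅⟩ : LoopConfig ℂ) x r R S = k S with hPA'B'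
    set PAB' : Prop := ∀ S : Finset (Fin n), S.Nonempty →
      patternCount (⟨fun j ↦ if j = 0 then {a, b'} else ∅⟩ : LoopConfig ℂ) x r R S = k S with hPAB'
    set PA'B : Prop := ∀ S : Finset (Fin n), S.Nonempty →
      patternCount (⟨fun j ↦ if j = 0 then {a', b} else ∅⟩ : LoopConfig ℂ) x r R S = k S with hPA'B
    rcases patternCount_switch hab hab' ha'b ha'b' hr hi hνA hwin hνb hνbi hνb' hνb'i x r R with
      hsw | hsw
    · have e₁ : PAB ↔ PAB' := forall_congr' fun S ↦ by rw [(hsw S).1]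
      have e₂ : PA'B' ↔ PA'B := forall_congr' fun S ↦ by rw [(hsw S).2]
      rw [if_congr e₁ rfl rfl, if_congr e₂ rfl rfl]
    · have e₁ : PAB ↔ PA'B := forall_congr' fun S ↦ by rw [(hsw S).1]
      have e₂ : PA'B' ↔ PAB' := forall_congr' fun S ↦ by rw [(hsw S).2]
      rw [if_congr e₁ rfl rfl, if_congr e₂ rfl rfl, add_comm]
  · -- the joint event under `X`: probability `1/2`
    rw [volume_setOf_apply_ite_lt_half (fun c : LoopConfig ℂ ↦
        patternCount c ![(3 / 2 : ℂ)] ![(1 / 10 : ℝ)] 3 Finset.univ = 1 ∧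
          patternCount c ![(1 / 2 : ℂ)] ![(1 / 10 : ℝ)] 3 Finset.univ = 1),
      if_pos ⟨NEab, NDab⟩, if_neg fun h ↦ ?_, add_zero]
    rw [NEa'b'] at h; exact zero_ne_one h.1
  · -- the joint event under `X'`: probability `0`
    rw [volume_setOf_apply_ite_lt_half (fun c : LoopConfig ℂ ↦
        patternCount c ![(3 / 2 : ℂ)] ![(1 / 10 : ℝ)] 3 Finset.univ = 1 ∧
          patternCount c ![(1 / 2 : ℂ)] ![(1 / 10 : ℝ)] 3 Finset.univ = 1),
      if_neg fun h ↦ ?_, if_neg fun h ↦ ?_, add_zero]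
    · rw [NEa'b] at h; exact zero_ne_one h.1
    · rw [NDab'] at h; exact (by norm_num : (2 : ℕ) ≠ 1) h.2
  · -- coupling distance `≥ 1/2`: no component of `X` is ever `ε`-close to a component of `X'`
    refine le_cnLawEDist_of_forall_not_isClose volume volume (by norm_num) fun ε hε hεr s s' ↦ ?_
    have hwε : closedBall (0 : ℂ) 2 ⊆ ball (0 : ℂ) (1 / ε) :=
      closedBall_subset_ball ((lt_one_div two_pos hε).2 hεr)
    have hε1 : ε < 1 := hεr.trans (by norm_num)
    split_ifs
    · refine not_isClose_of_far (u := b) (by rw [hF0]; exact Or.inr rfl) (hRb0.trans hwε) fun u' hu' ↦ ?_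
      rw [hF0] at hu'
      rcases hu' with rfl | rfl
      exacts [hε1.trans_le hD_ba, hε1.trans_le hD_bb']
    · refine not_isClose_of_far (u := a) (by rw [hF0]; exact Or.inl rfl) (hRa.trans hwε) fun u' hu' ↦ ?_
      rw [hF0] at hu'
      rcases hu' with rfl | rfl
      exacts [hε1.trans_le hD_aa', hε1.trans_le hD_ab]
    · refine not_isClose_of_far (u := a') (by rw [hF0]; exact Or.inl rfl) (hRa'.trans hwε) fun u' hu' ↦ ?_
      rw [hF0] at hu'
      rcases hu' with rfl | rfl
      exacts [hε1.trans_le hD_a'a, hε1.trans_le hD_a'b']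
    · refine not_isClose_of_far (u := b') (by rw [hF0]; exact Or.inr rfl) (hRb'0.trans hwε) fun u' hu' ↦ ?_
      rw [hF0] at hu'
      rcases hu' with rfl | rfl
      exacts [hε1.trans_le hD_b'a', hε1.trans_le hD_b'b]

end Summit.CriticalPhenomena.CardyFormulaZ2.Cruxes.NestingRigidity.PositiveConeWeightDoubling

end
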